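import Mathlib

/-!
# Hecke transport — the algebraic heart of child B of `HeckeFieldOfCruxes` (stmt-Langlands-10432)

Abstract linear algebra (no automorphic content). Let `W` be a `ℂ`-vector space, `S ⊆ W` a set which is
stable under a family of `ℂ`-linear operators `L i`, and suppose that finite `ℚ`-linearly independent
families drawn from `S` are `ℂ`-linearly independent (the "injectivity interface" of the route
`RationalPeriodQuarter`: `ℂ ⊗_ℚ span_ℚ S → W` is injective). If `0 ≠ u ∈ span_ℂ S` is a simultaneous
eigenvector, `L i u = a i • u`, then all `a i` lie in ONE number field. Proof: `V := span_ℚ S` carries the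
restricted `ℚ`-linear operators `T i`; `ι : ℂ ⊗_ℚ V → W`, `c ⊗ v ↦ c • v`, is injective by the interface
(expand in the basis `1 ⊗ bₖ`, `bₖ ∈ S` a `ℚ`-basis of `V`), intertwines `(T i)_ℂ` with `L i`, and its range
contains `span_ℂ S`; transporting the eigen-equations to `w := ι⁻¹ u` and applying the PROVED
descending-chain lemma `rationalEigencharacterLemma` (stmt-2809) gives the field.
-/

set_option linter.dupNamespace false

namespace Summit.Langlands.Langlands.Theorems

open TensorProduct Submodule

/-- The `ℂ`-linear evaluation map `ℂ ⊗_ℚ V → W`, `c ⊗ v ↦ c • v`, for a `ℚ`-submodule `V` of a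
`ℂ`-module `W`. -/
noncomputable def hkTransportEval {W : Type} [AddCommGroup W] [Module ℂ W] [Module ℚ W] [IsScalarTower ℚ ℂ W] (V : Submodule ℚ W) :
    ℂ ⊗[ℚ] V →ₗ[ℂ] W :=
  TensorProduct.AlgebraTensorModule.lift
    { toFun := fun c => c • (V.subtype)
      map_add' := fun c₁ c₂ => by ext v; simp [add_smul]
      map_smul' := fun c c' => by ext v; simp [mul_smul] }

/-- `ι (c ⊗ v) = c • v`. -/
theorem hkTransportEval_tmul {W : Type} [AddCommGroup W] [Module ℂ W] [Module ℚ W] [IsScalarTower ℚ ℂ W] (V : Submodule ℚ W)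
    (c : ℂ) (v : V) : hkTransportEval V (c ⊗ₜ[ℚ] v) = c • (v : W) := by
  simp [hkTransportEval]

/-- `ι` intertwines the base change of a restricted operator with the operator. -/
theorem hkTransportEval_baseChange {W : Type} [AddCommGroup W] [Module ℂ W] [Module ℚ W] [IsScalarTower ℚ ℂ W] (V : Submodule ℚ W)
    (L : W →ₗ[ℂ] W) (hV : ∀ x ∈ V, L x ∈ V) (x : ℂ ⊗[ℚ] V) :
    hkTransportEval V (((L.restrictScalars ℚ).restrict hV).baseChange ℂ x) =
      L (hkTransportEval V x) := by
  induction x using TensorProduct.induction_on with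
  | zero => simp
  | tmul c v =>
      rw [LinearMap.baseChange_tmul, hkTransportEval_tmul, hkTransportEval_tmul, map_smul]
      rfl
  | add x y hx hy => simp [map_add, hx, hy]

/-- Injectivity of `ι` from the independence interface. -/
theorem hkTransportEval_injective {W : Type} [AddCommGroup W] [Module ℂ W] [Module ℚ W] [IsScalarTower ℚ ℂ W] (S : Set W)
    (hind : ∀ (m : ℕ) (v : Fin m → W), (∀ j, v j ∈ S) →
      LinearIndependent ℚ v → LinearIndependent ℂ v) :
    Function.Injective (hkTransportEval (span ℚ S)) := by
  classical
  set V : Submodule ℚ W := span ℚ S with hVdef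
  -- a `ℚ`-basis of `V` inside `S`
  obtain ⟨b, hbS, hbspan, hblin⟩ := exists_linearIndependent ℚ S
  have hrange : Set.range (Subtype.val : b → W) = b := Subtype.range_coe
  let B₀ : Module.Basis b ℚ (span ℚ (Set.range (Subtype.val : b → W))) := Module.Basis.span hblin
  have heq : span ℚ (Set.range (Subtype.val : b → W)) = V := by rw [hrange, hbspan]
  let B : Module.Basis b ℚ V := B₀.map (LinearEquiv.ofEq _ _ heq)
  have hBval : ∀ k : b, ((B k : V) : W) = (k : W) := by
    intro k
    simp [B, B₀, Module.Basis.map_apply, Module.Basis.span_apply]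
  -- the `ℂ`-basis `1 ⊗ B k` of `ℂ ⊗ V`
  let BC : Module.Basis b ℂ (ℂ ⊗[ℚ] V) := Algebra.TensorProduct.basis ℂ B
  have hBC : ∀ k, hkTransportEval V (BC k) = (k : W) := by
    intro k
    simp only [BC, Algebra.TensorProduct.basis_apply, hkTransportEval_tmul, one_smul, hBval]
  rw [injective_iff_map_eq_zero]
  intro x hx
  -- expand `x` in the basis `BC`
  have hxrepr := BC.linearCombination_repr x
  set g := BC.repr x with hg
  have hsum : hkTransportEval V x = ∑ k ∈ g.support, g k • (k : W) := by
    conv_lhs => rw [← hxrepr]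
    rw [Finsupp.linearCombination_apply, Finsupp.sum, map_sum]
    refine Finset.sum_congr rfl fun k _ => ?_
    rw [map_smul, hBC]
  -- reindex the finite support by `Fin m`
  set s : Finset b := g.support with hs
  let e : s ≃ Fin s.card := s.equivFin
  let v : Fin s.card → W := fun j => ((e.symm j : s) : b)
  have hvS : ∀ j, v j ∈ S := fun j => hbS ((e.symm j : s) : b).2
  -- `ℚ`-independence of `v`: it is a subfamily of the basis `B` pushed into `W`
  have hBW : LinearIndependent ℚ (fun k : b => (k : W)) := by
    have := hblin
    simpa using this
  have hvQ : LinearIndependent ℚ v := by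
    have h1 : LinearIndependent ℚ ((fun k : b => (k : W)) ∘ (fun j : Fin s.card => ((e.symm j : s) : b))) :=
      hBW.comp _ (by
        intro j₁ j₂ h
        have : (e.symm j₁ : s) = e.symm j₂ := Subtype.ext h
        simpa using this)
    exact h1
  have hvC : LinearIndependent ℂ v := hind _ v hvS hvQ
  -- the vanishing combination
  have hcomb : ∑ j, g ((e.symm j : s) : b) • v j = 0 := by
    have h1 : ∑ k ∈ s, g k • ((k : b) : W) = ∑ k : s, g (k : b) • (((k : s) : b) : W) :=
      (Finset.sum_coe_sort s (fun k : b => g k • ((k : b) : W))).symm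
    have h2 : ∑ k : s, g (k : b) • (((k : s) : b) : W) = ∑ j, g ((e.symm j : s) : b) • v j :=
      Fintype.sum_equiv e _ _ (fun k => by simp only [v, Equiv.symm_apply_apply])
    rw [← h2, ← h1, ← hsum, hx]
  have hzero : ∀ j, g ((e.symm j : s) : b) = 0 := Fintype.linearIndependent_iff.1 hvC _ hcomb
  -- hence `g = 0` and `x = 0`
  have hg0 : g = 0 := by
    ext k
    by_cases hk : k ∈ s
    · have := hzero (e ⟨k, hk⟩)
      simpa using this
    · simpa [hs, Finsupp.mem_support_iff] using hk
  rw [← hxrepr, hg0, map_zero]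

/-- The range of `ι` contains `span_ℂ S`. -/
theorem hkTransportEval_span_le {W : Type} [AddCommGroup W] [Module ℂ W] [Module ℚ W] [IsScalarTower ℚ ℂ W] (S : Set W) :
    span ℂ S ≤ LinearMap.range (hkTransportEval (span ℚ S)) := by
  rw [span_le]
  intro s hs
  refine ⟨(1 : ℂ) ⊗ₜ[ℚ] ⟨s, subset_span hs⟩, ?_⟩
  rw [hkTransportEval_tmul, one_smul]

/-- ABSTRACT HECKE TRANSPORT (route-independent: the descending-chain lemma of stmt-2809 —
`Theses.RationalPeriodQuarter.RationalEigencharacterLemma`, proved as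
`Theorems.RationalPeriodQuarterEigencharacter.rationalEigencharacterLemma` — enters as the hypothesis `hREL`,
spelled out verbatim, so that this file imports Mathlib only). -/
theorem heckeField_of_transport
    (hREL : ∀ (V : Type) [AddCommGroup V] [Module ℚ V] (ι : Type) (T : ι → V →ₗ[ℚ] V) (a : ι → ℂ)
      (w : TensorProduct ℚ ℂ V), w ≠ 0 → (∀ i, (T i).baseChange ℂ w = a i • w) →
      ∃ E : IntermediateField ℚ ℂ, FiniteDimensional ℚ E ∧ ∀ i, a i ∈ E)
    {W : Type} [AddCommGroup W] [Module ℂ W] [Module ℚ W] [IsScalarTower ℚ ℂ W] (S : Set W) {ι : Type}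
    (L : ι → W →ₗ[ℂ] W) (hLS : ∀ i, ∀ s ∈ S, L i s ∈ S)
    (hind : ∀ (m : ℕ) (v : Fin m → W), (∀ j, v j ∈ S) →
      LinearIndependent ℚ v → LinearIndependent ℂ v)
    (u : W) (hu : u ∈ span ℂ S) (hu0 : u ≠ 0) (a : ι → ℂ) (heig : ∀ i, L i u = a i • u) :
    ∃ E : IntermediateField ℚ ℂ, FiniteDimensional ℚ E ∧ ∀ i, a i ∈ E := by
  classical
  set V : Submodule ℚ W := span ℚ S with hVdef
  have hV : ∀ i, ∀ x ∈ V, L i x ∈ V := by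
    intro i x hx
    refine span_induction (p := fun x _ => L i x ∈ V) ?_ ?_ ?_ ?_ hx
    · intro s hs; exact subset_span (hLS i s hs)
    · simp
    · intro x y _ _ hx hy; simpa [map_add] using V.add_mem hx hy
    · intro q x _ hx
      have : L i (q • x) = q • L i x := by
        rw [← (L i).map_smul_of_tower q x]
      rw [this]; exact V.smul_mem q hx
  let T : ι → V →ₗ[ℚ] V := fun i => ((L i).restrictScalars ℚ).restrict (hV i)
  have hinj := hkTransportEval_injective S hind
  obtain ⟨w, hw⟩ : u ∈ LinearMap.range (hkTransportEval V) := hkTransportEval_span_le S hu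
  have hw0 : w ≠ 0 := by
    rintro rfl
    exact hu0 (by rw [← hw, map_zero])
  have hT : ∀ i, (T i).baseChange ℂ w = a i • w := by
    intro i
    apply hinj
    rw [hkTransportEval_baseChange V (L i) (hV i) w, map_smul, hw, heig]
  exact hREL V ι T a w hw0 hT

end Summit.Langlands.Langlands.Theorems
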